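import Literature.Probability.LatticeModels.KCGaugedSections
import HarnessLib

/-!
# The gauged difference `χ_σ F_{[Ω_δ,a,b…]} - S₀' · F_{[ℂ_δ,a]}` near the source (CHI Lemma 3.5 for `k ≥ 1`)

Topic `Literature/Probability/LatticeModels`. Chelkak–Hongler–Izyurov 2015, Lemma 3.5 and Remark 3.9,
for the observable WITH background spins `B` (the `k ≥ 1` case of Thm 2.16): in the tree's frame the
signed Kadanoff–Ceva observable `kcObs G₂ Λ η B cut` carries, besides the seam of the source, the seams
of the background spins; after the row gauge `rowGauge σ` of `KCGaugedSections.lean` (which hides the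
latter in a chart) the difference with the gauged explicit spinor `slitFCg p₀`
(`SlitPlaneSeamMatching.lean`), scaled by the SIGNED source magnetisation
`S₀' = σ(p₀ 1) · rowSign B (p₀ 1) · E[σ_{v₀} σ_B]`, has VANISHING projections at the source corner and
the table of an s-holomorphic spinor section around it:

* `frameCoord_kcObs_source_general`: CHI Lemma 3.2 with background spins — the index-`2` frame
  projections of `kcObs … B cut` on the west / south bond of `v₀ = p₀ + e₀ + e₁` are
  `2 · hLowSign B (p₀ + e₁) · S₀ · N₀` and `2 · rowSign B (p₀ 1) · S₀ · N₀`, `S₀ = kcS … B ∅ v₀`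
  (generalising `frameCoord_kcObs_source`, `B = ∅`);
* `kcDiffG σ … B cut p₀ S` (the gauged difference), `frameCoord_kcDiffG_source`,
  `projLine_kcDiffG_source` (both projections vanish at the source corner under the source gauge
  condition `σ(p₀ 1 + 1) · hLowSign B (p₀ + e₁) = -σ(p₀ 1) · rowSign B (p₀ 1)`), hence
  `isSHolAt_kcDiffG_source` AND `isAntiAt_kcDiffG_source`;
* the table off the source: `isSHolAt_kcDiffG_zero/one` (always), `isSHolAt_kcDiffG_two/three` (off
  the seam, where the gauged section is s-holomorphic), `isAntiAt_kcDiffG_two/three` (on the seam);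
  gauge lemmas `isAntiAt_sign_mul_iff`, `isAntiAt_rowGauge_kcObs_two/three`.

Everything is proved; no named fact.

## References

* D. Chelkak, C. Hongler, K. Izyurov, Ann. of Math. 181 (2015) = arXiv:1202.2838, Lemma 3.2,
  Lemma 3.5, Remark 3.9 [ChelkakHonglerIzyurovAnnals2015].
-/

noncomputable section

namespace Literature.Probability.LatticeModels

open Complex ComplexConjugate SimpleGraph

/-! ### Gauge lemmas -/

/-- **Gauge lemma, equal signs, anti form**: a bond sign agreeing on the two bonds of a corner does
not change `IsAntiAt` there. [folklore] -/
theorem isAntiAt_sign_mul_iff {χ : MedialVertex → ℝ} {F : MedialVertex → ℂ} {q : Site 2 × Fin 4}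
    (hχ : χ (cSrc q) = 1 ∨ χ (cSrc q) = -1) (heq : χ (cTgt q) = χ (cSrc q)) :
    IsAntiAt (fun e => (χ e : ℂ) * F e) q ↔ IsAntiAt F q := by
  have hs : (χ (cSrc q) : ℂ) ≠ 0 := by
    rcases hχ with h | h <;> rw [h] <;> norm_num
  unfold IsAntiAt
  simp only [heq, projLine_ofReal_mul_right]
  constructor
  · intro h; exact mul_left_cancel₀ hs (h.trans (by ring))
  · intro h; rw [h]; ring

/-- Frame coordinates are real-linear: a real bond factor comes out. [folklore] -/
theorem re_frameCoord_ofReal_mul (t : ℝ) (X : ℂ) (n : ℕ) :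
    (frameCoord 0 ((t : ℂ) * X) * (1 + I) ^ n).re = t * (frameCoord 0 X * (1 + I) ^ n).re := by
  simp only [frameCoord]
  rw [show (t : ℂ) * X * (starRingEnd ℂ) (frameVec 0) * (1 + I) ^ n = (t : ℂ) * (X * (starRingEnd ℂ) (frameVec 0) * (1 + I) ^ n) by ring,
    Complex.re_ofReal_mul]

/-- Frame coordinates are real-linear: differences with a real multiple. [folklore] -/
theorem re_frameCoord_sub_ofReal_mul (S : ℝ) (X Y : ℂ) (n : ℕ) :
    (frameCoord 0 (X - (S : ℂ) * Y) * (1 + I) ^ n).re =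
      (frameCoord 0 X * (1 + I) ^ n).re - S * (frameCoord 0 Y * (1 + I) ^ n).re := by
  simp only [frameCoord]
  rw [show (X - (S : ℂ) * Y) * (starRingEnd ℂ) (frameVec 0) * (1 + I) ^ n =
    X * (starRingEnd ℂ) (frameVec 0) * (1 + I) ^ n - (S : ℂ) * (Y * (starRingEnd ℂ) (frameVec 0) * (1 + I) ^ n) by ring,
    Complex.sub_re, Complex.re_ofReal_mul]

section Source

variable (G₂ : SimpleGraph (Site 2)) [G₂.LocallyFinite]
variable {Λ : Finset (Site 2)} {η : SpinConfig (Site 2)} {B : Finset (Site 2)} {cut : Site 2 → Finset (Sym2 (Site 2))}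

/-- Rows at the source: `v₀ 1 = p₀ 1 + 1`, `(p₀ + e₀) 1 = p₀ 1`, `(p₀ + e₁) 1 = p₀ 1 + 1`. [folklore] -/
theorem source_rows (p₀ : Site 2) :
    (p₀ + cornerUnit 0 + cornerUnit 1) 1 = p₀ 1 + 1 ∧ (p₀ + cornerUnit 0) 1 = p₀ 1 ∧ (p₀ + cornerUnit 1) 1 = p₀ 1 + 1 := by
  refine ⟨?_, ?_, ?_⟩ <;> simp [cornerUnit]

/-- **The spin fermion with background spins at the source corner** (CHI Lemma 3.2, `k ≥ 1`): for a cut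
system with `cut p₀ = ∅` whose cut at `p₀ + e₀` is the admissible toggle of the bond `{p₀ + e₀, v₀}`,
the index-`2` frame projections of `kcObs … B cut` on the west and on the south bond of
`v₀ = p₀ + e₀ + e₁` are `2 · hLowSign B (p₀ + e₁) · S₀ · N₀` and `2 · rowSign B (p₀ 1) · S₀ · N₀`,
`S₀ = kcS … B ∅ v₀ = E[σ_{v₀} σ_B]`. [cite: ChelkakHonglerIzyurovAnnals2015, Lemma 3.2] -/
theorem frameCoord_kcObs_source_general (hG : ∀ v ∈ Λ, ∀ k : Fin 4, G₂.Adj v (v + cornerUnit k)) (hle : G₂ ≤ zdGraph 2)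
    (p₀ : Site 2) (h0 : cut p₀ = ∅)
    (he : s(p₀ + cornerUnit 0, p₀ + cornerUnit 0 + cornerUnit 1) ∈ edgesTouching G₂ Λ)
    (hstep : KCGaugeEquiv G₂ Λ (symmDiff (cut (faceAt (p₀ + cornerUnit 0) 1)) {s(p₀ + cornerUnit 0, p₀ + cornerUnit 0 + cornerUnit 1)})
      (cut (faceAt (p₀ + cornerUnit 0) 0))) :
    (frameCoord 0 (kcObs G₂ Λ η B cut (cSrc (p₀ + cornerUnit 0 + cornerUnit 1, 2))) * (1 + I) ^ 2).re =
        2 * (hLowSign B (p₀ + cornerUnit 1) * kcS G₂ Λ criticalBetaTwo (.fixed η) B ∅ (p₀ + cornerUnit 0 + cornerUnit 1)) * frameNorm 0 0 ∧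
    (frameCoord 0 (kcObs G₂ Λ η B cut (cTgt (p₀ + cornerUnit 0 + cornerUnit 1, 2))) * (1 + I) ^ 2).re =
        2 * (rowSign B (p₀ 1) * kcS G₂ Λ criticalBetaTwo (.fixed η) B ∅ (p₀ + cornerUnit 0 + cornerUnit 1)) * frameNorm 0 0 := by
  obtain ⟨hw, hs⟩ := source_neighbours p₀
  obtain ⟨hf3, hf1, hv, hf0⟩ := source_faces p₀
  obtain ⟨-, hr0, -⟩ := source_rows p₀
  constructor
  · -- the west bond `{p₀ + e₁, v₀}`: `d = hLowSign B (p₀ + e₁) · kcS(cut p₀ = ∅)(v₀)`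
    simp only [cSrc]
    rw [westBond_eq, kcObs_east, hw, kcObsH, re_frameCoord_kcVec0_two, hf3, h0, hv]
  · -- the south bond `{p₀ + e₀, v₀}`: toggle across it from `cut p₀ = ∅`
    simp only [cTgt, show (2 : Fin 4) + 1 = 3 from rfl]
    rw [southBond_eq, kcObs_north, hs]
    have hT : cut (faceAt (p₀ + cornerUnit 0) 1) ⊆ edgesTouching G₂ Λ := by
      rw [hf1, h0]; exact Finset.empty_subset _
    have hsub := symmDiff_singleton_subset_edgesTouching G₂ hT he
    rw [kcObsV, re_frameCoord_kcVec1_two, vLowSign, hstep.kcS_eq G₂ hG hle hsub, kcS_toggle_vertical_top, hf1, h0,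
      (signs_empty (p₀ + cornerUnit 0) ((p₀ + cornerUnit 0) 1) s(p₀, p₀)).2.2.1, frameNorm_succ, hr0]
    have hs2 : Real.sqrt 2 ^ 2 = 2 := Real.sq_sqrt zero_le_two
    linear_combination (rowSign B (p₀ 1) * kcS G₂ Λ criticalBetaTwo (.fixed η) B ∅ (p₀ + cornerUnit 0 + cornerUnit 1) *
      frameNorm 0 0) * hs2

/-- **The gauged difference** `D = χ_σ · F_{[Ω_δ,a,b…]} - S · χ F_{[ℂ_δ,a]}`: the row-gauged spin fermion
with background spins minus the gauged explicit spinor scaled by `S`. [cite: ChelkakHonglerIzyurovAnnals2015, Lemma 3.5 and Remark 3.9] -/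
def kcDiffG (σ : ℤ → ℝ) (Λ : Finset (Site 2)) (η : SpinConfig (Site 2)) (B : Finset (Site 2))
    (cut : Site 2 → Finset (Sym2 (Site 2))) (p₀ : Site 2) (S : ℝ) (e : MedialVertex) : ℂ :=
  rowGauge σ (kcObs G₂ Λ η B cut) e - (S : ℂ) * slitFCg p₀ e

/-- Unfolding `kcDiffG` as `χ F - S G`. [folklore] -/
theorem kcDiffG_eq (σ : ℤ → ℝ) (p₀ : Site 2) (S : ℝ) :
    kcDiffG G₂ σ Λ η B cut p₀ S = fun e => rowGauge σ (kcObs G₂ Λ η B cut) e - (S : ℂ) * slitFCg p₀ e := rfl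

/-- **The signed source magnetisation** `S₀' = σ(p₀ 1) · rowSign B (p₀ 1) · E[σ_{v₀} σ_B]`. [cite: ChelkakHonglerIzyurovAnnals2015, Lemma 3.2 (normalisation)] -/
def srcMag (σ : ℤ → ℝ) (Λ : Finset (Site 2)) (η : SpinConfig (Site 2)) (B : Finset (Site 2)) (p₀ : Site 2) : ℝ :=
  σ (p₀ 1) * rowSign B (p₀ 1) * kcS G₂ Λ criticalBetaTwo (.fixed η) B ∅ (p₀ + cornerUnit 0 + cornerUnit 1)

/-- `|S₀'| = |S₀|`: `S₀'² = S₀²`. [folklore] -/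
theorem srcMag_sq {σ : ℤ → ℝ} (hσ : ∀ r, σ r = 1 ∨ σ r = -1) (p₀ : Site 2) :
    srcMag G₂ σ Λ η B p₀ ^ 2 = kcS G₂ Λ criticalBetaTwo (.fixed η) B ∅ (p₀ + cornerUnit 0 + cornerUnit 1) ^ 2 := by
  rw [srcMag, mul_pow, mul_pow]
  have h1 : σ (p₀ 1) ^ 2 = 1 := by rcases hσ (p₀ 1) with h | h <;> rw [h] <;> norm_num
  have h2 : rowSign B (p₀ 1) ^ 2 = 1 := by rcases rowSign_cases B (p₀ 1) with h | h <;> rw [h] <;> norm_num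
  rw [h1, h2, one_mul, one_mul]

/-- **Both frame projections of the gauged difference vanish at the source corner** (Lemma 3.5 with
background spins) under the SOURCE GAUGE CONDITION
`σ(p₀ 1 + 1) · hLowSign B (p₀ + e₁) = -σ(p₀ 1) · rowSign B (p₀ 1)`. [cite: ChelkakHonglerIzyurovAnnals2015, Lemma 3.5] -/
theorem frameCoord_kcDiffG_source (hG : ∀ v ∈ Λ, ∀ k : Fin 4, G₂.Adj v (v + cornerUnit k)) (hle : G₂ ≤ zdGraph 2)
    (p₀ : Site 2) (h0 : cut p₀ = ∅)
    (he : s(p₀ + cornerUnit 0, p₀ + cornerUnit 0 + cornerUnit 1) ∈ edgesTouching G₂ Λ)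
    (hstep : KCGaugeEquiv G₂ Λ (symmDiff (cut (faceAt (p₀ + cornerUnit 0) 1)) {s(p₀ + cornerUnit 0, p₀ + cornerUnit 0 + cornerUnit 1)})
      (cut (faceAt (p₀ + cornerUnit 0) 0)))
    (σ : ℤ → ℝ) (hsrc : σ (p₀ 1 + 1) * hLowSign B (p₀ + cornerUnit 1) = -(σ (p₀ 1) * rowSign B (p₀ 1))) :
    (frameCoord 0 (kcDiffG G₂ σ Λ η B cut p₀ (srcMag G₂ σ Λ η B p₀) (cSrc (p₀ + cornerUnit 0 + cornerUnit 1, 2))) * (1 + I) ^ 2).re = 0 ∧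
    (frameCoord 0 (kcDiffG G₂ σ Λ η B cut p₀ (srcMag G₂ σ Λ η B p₀) (cTgt (p₀ + cornerUnit 0 + cornerUnit 1, 2))) * (1 + I) ^ 2).re = 0 := by
  obtain ⟨hk1, hk2⟩ := frameCoord_kcObs_source_general G₂ (η := η) (B := B) hG hle p₀ h0 he hstep
  obtain ⟨hf1, hf2⟩ := frameCoord_slitFC_source p₀
  obtain ⟨hc1, hc2⟩ := slitChi_source p₀
  obtain ⟨hr1, hr2⟩ := rowChi_corner_two σ (p₀ + cornerUnit 0 + cornerUnit 1)
  obtain ⟨hv1, -, -⟩ := source_rows p₀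
  rw [hv1] at hr1 hr2
  rw [show p₀ 1 + 1 - 1 = p₀ 1 by ring] at hr2
  set S₀ := kcS G₂ Λ criticalBetaTwo (.fixed η) B ∅ (p₀ + cornerUnit 0 + cornerUnit 1)
  constructor
  · simp only [kcDiffG, rowGauge, slitFCg]
    rw [re_frameCoord_sub_ofReal_mul, re_frameCoord_ofReal_mul, re_frameCoord_ofReal_mul, hr1, hk1, hc1, hf1, srcMag]
    linear_combination (2 * frameNorm 0 0 * S₀) * hsrc
  · simp only [kcDiffG, rowGauge, slitFCg]
    rw [re_frameCoord_sub_ofReal_mul, re_frameCoord_ofReal_mul, re_frameCoord_ofReal_mul, hr2, hk2, hc2, hf2, srcMag]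
    ring

/-- **Both projections of the gauged difference onto the source corner line vanish.** [cite: ChelkakHonglerIzyurovAnnals2015, Lemma 3.5] -/
theorem projLine_kcDiffG_source (hG : ∀ v ∈ Λ, ∀ k : Fin 4, G₂.Adj v (v + cornerUnit k)) (hle : G₂ ≤ zdGraph 2)
    (p₀ : Site 2) (h0 : cut p₀ = ∅)
    (he : s(p₀ + cornerUnit 0, p₀ + cornerUnit 0 + cornerUnit 1) ∈ edgesTouching G₂ Λ)
    (hstep : KCGaugeEquiv G₂ Λ (symmDiff (cut (faceAt (p₀ + cornerUnit 0) 1)) {s(p₀ + cornerUnit 0, p₀ + cornerUnit 0 + cornerUnit 1)})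
      (cut (faceAt (p₀ + cornerUnit 0) 0)))
    (σ : ℤ → ℝ) (hsrc : σ (p₀ 1 + 1) * hLowSign B (p₀ + cornerUnit 1) = -(σ (p₀ 1) * rowSign B (p₀ 1))) :
    projLine (cornerLine (p₀ + cornerUnit 0 + cornerUnit 1) (faceAt (p₀ + cornerUnit 0 + cornerUnit 1) 2))
        (kcDiffG G₂ σ Λ η B cut p₀ (srcMag G₂ σ Λ η B p₀) (cSrc (p₀ + cornerUnit 0 + cornerUnit 1, 2))) = 0 ∧
    projLine (cornerLine (p₀ + cornerUnit 0 + cornerUnit 1) (faceAt (p₀ + cornerUnit 0 + cornerUnit 1) 2))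
        (kcDiffG G₂ σ Λ η B cut p₀ (srcMag G₂ σ Λ η B p₀) (cTgt (p₀ + cornerUnit 0 + cornerUnit 1, 2))) = 0 := by
  obtain ⟨h1, h2⟩ := frameCoord_kcDiffG_source G₂ hG hle p₀ h0 he hstep σ hsrc
  exact ⟨projLine_cornerLine_eq_zero _ 2 (n := 2) (by norm_num) h1, projLine_cornerLine_eq_zero _ 2 (n := 2) (by norm_num) h2⟩

/-- **Lemma 3.5 with background spins**: the gauged difference is s-holomorphic at the source corner. [cite: ChelkakHonglerIzyurovAnnals2015, Lemma 3.5] -/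
theorem isSHolAt_kcDiffG_source (hG : ∀ v ∈ Λ, ∀ k : Fin 4, G₂.Adj v (v + cornerUnit k)) (hle : G₂ ≤ zdGraph 2)
    (p₀ : Site 2) (h0 : cut p₀ = ∅)
    (he : s(p₀ + cornerUnit 0, p₀ + cornerUnit 0 + cornerUnit 1) ∈ edgesTouching G₂ Λ)
    (hstep : KCGaugeEquiv G₂ Λ (symmDiff (cut (faceAt (p₀ + cornerUnit 0) 1)) {s(p₀ + cornerUnit 0, p₀ + cornerUnit 0 + cornerUnit 1)})
      (cut (faceAt (p₀ + cornerUnit 0) 0)))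
    (σ : ℤ → ℝ) (hsrc : σ (p₀ 1 + 1) * hLowSign B (p₀ + cornerUnit 1) = -(σ (p₀ 1) * rowSign B (p₀ 1))) :
    IsSHolAt (kcDiffG G₂ σ Λ η B cut p₀ (srcMag G₂ σ Λ η B p₀)) (p₀ + cornerUnit 0 + cornerUnit 1, 2) := by
  obtain ⟨h1, h2⟩ := projLine_kcDiffG_source G₂ hG hle p₀ h0 he hstep σ hsrc
  unfold IsSHolAt
  simp only [cFace]
  rw [h1, h2]

/-- … and ALSO anti there (both projections vanish), which is what the local gauges of the Laplacian
sign computation use. [cite: ChelkakHonglerIzyurovAnnals2015, Lemma 3.5 and Remark 3.9] -/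
theorem isAntiAt_kcDiffG_source (hG : ∀ v ∈ Λ, ∀ k : Fin 4, G₂.Adj v (v + cornerUnit k)) (hle : G₂ ≤ zdGraph 2)
    (p₀ : Site 2) (h0 : cut p₀ = ∅)
    (he : s(p₀ + cornerUnit 0, p₀ + cornerUnit 0 + cornerUnit 1) ∈ edgesTouching G₂ Λ)
    (hstep : KCGaugeEquiv G₂ Λ (symmDiff (cut (faceAt (p₀ + cornerUnit 0) 1)) {s(p₀ + cornerUnit 0, p₀ + cornerUnit 0 + cornerUnit 1)})
      (cut (faceAt (p₀ + cornerUnit 0) 0)))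
    (σ : ℤ → ℝ) (hsrc : σ (p₀ 1 + 1) * hLowSign B (p₀ + cornerUnit 1) = -(σ (p₀ 1) * rowSign B (p₀ 1))) :
    IsAntiAt (kcDiffG G₂ σ Λ η B cut p₀ (srcMag G₂ σ Λ η B p₀)) (p₀ + cornerUnit 0 + cornerUnit 1, 2) := by
  obtain ⟨h1, h2⟩ := projLine_kcDiffG_source G₂ hG hle p₀ h0 he hstep σ hsrc
  unfold IsAntiAt
  simp only [cFace]
  rw [h1, h2, neg_zero]

end Source

/-! ### The table of the gauged difference off the source -/

section Table

variable (G₂ : SimpleGraph (Site 2)) [G₂.LocallyFinite]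
variable {Λ : Finset (Site 2)} {η : SpinConfig (Site 2)} {B : Finset (Site 2)} {cut : Site 2 → Finset (Sym2 (Site 2))}
variable {σ : ℤ → ℝ}

/-- **Lower corner `(y, SW)`, anti form**: the gauged section is anti when
`hLowSign (y - e₀) · vLowSign (y - e₁) = -σ(y₁ - 1) σ(y₁)`. [cite: ChelkakHonglerIzyurovAnnals2015, Prop. 2.4 and §3.2] -/
theorem isAntiAt_rowGauge_kcObs_two (hσ : ∀ r, σ r = 1 ∨ σ r = -1)
    (hG : ∀ v ∈ Λ, ∀ k : Fin 4, G₂.Adj v (v + cornerUnit k)) (hle : G₂ ≤ zdGraph 2)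
    {y : Site 2} (hT : cut (faceAt y 2) ⊆ edgesTouching G₂ Λ)
    (he : s(y + cornerUnit 3, y + cornerUnit 3 + cornerUnit 1) ∈ edgesTouching G₂ Λ)
    (hstep : KCGaugeEquiv G₂ Λ (symmDiff (cut (faceAt y 2)) {s(y + cornerUnit 3, y + cornerUnit 3 + cornerUnit 1)})
      (cut (faceAt y 3)))
    (hsign : hLowSign B (y + cornerUnit 2) * vLowSign B cut (y + cornerUnit 3) = -(σ (y 1 - 1) * σ (y 1))) :
    IsAntiAt (rowGauge σ (kcObs G₂ Λ η B cut)) (y, 2) := by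
  obtain ⟨h1, h2⟩ := rowChi_corner_two σ y
  have hχ : rowChi σ (cSrc (y, 2)) = 1 ∨ rowChi σ (cSrc (y, 2)) = -1 := by rw [h1]; exact hσ _
  have hhv := pm_eq_of_mul_eq (hLowSign_cases B (y + cornerUnit 2)) (vLowSign_cases B cut (y + cornerUnit 3))
  have hss := pm_eq_of_mul_eq (hσ (y 1 - 1)) (hσ (y 1))
  rcases pm_mul (hσ (y 1 - 1)) (hσ (y 1)) with hp | hp
  · -- equal gauge signs: the section is anti at the corner
    have heq : rowChi σ (cTgt (y, 2)) = rowChi σ (cSrc (y, 2)) := by rw [h1, h2, hss.1 hp]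
    rw [hp] at hsign
    exact (isAntiAt_sign_mul_iff (χ := rowChi σ) hχ heq).2
      (isAntiAt_kcObs_two G₂ hG hle hT he hstep (hhv.2 hsign))
  · -- opposite gauge signs: the section is s-holomorphic at the corner
    have hop : rowChi σ (cTgt (y, 2)) = -rowChi σ (cSrc (y, 2)) := by rw [h1, h2, hss.2 hp]
    rw [hp, neg_neg] at hsign
    exact ((isSHolAt_sign_mul_iff_anti (χ := rowChi σ) hχ hop).2).2
      (isSHolAt_kcObs_two G₂ hG hle hT he hstep (hhv.1 hsign))

/-- **Lower corner `(y, SE)`, anti form.** [cite: ChelkakHonglerIzyurovAnnals2015, Prop. 2.4 and §3.2] -/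
theorem isAntiAt_rowGauge_kcObs_three (hσ : ∀ r, σ r = 1 ∨ σ r = -1)
    (hG : ∀ v ∈ Λ, ∀ k : Fin 4, G₂.Adj v (v + cornerUnit k)) (hle : G₂ ≤ zdGraph 2)
    {y : Site 2} (hT : cut (faceAt y 0) ⊆ edgesTouching G₂ Λ) (he : s(y, y + cornerUnit 0) ∈ edgesTouching G₂ Λ)
    (hstep : KCGaugeEquiv G₂ Λ (symmDiff (cut (faceAt y 0)) {s(y, y + cornerUnit 0)}) (cut (faceAt y 3)))
    (hsign : vLowSign B cut (y + cornerUnit 3) * hLowSign B y = -(σ (y 1 - 1) * σ (y 1))) :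
    IsAntiAt (rowGauge σ (kcObs G₂ Λ η B cut)) (y, 3) := by
  obtain ⟨h1, h2⟩ := rowChi_corner_three σ y
  have hχ : rowChi σ (cSrc (y, 3)) = 1 ∨ rowChi σ (cSrc (y, 3)) = -1 := by rw [h1]; exact hσ _
  have hhv := pm_eq_of_mul_eq (vLowSign_cases B cut (y + cornerUnit 3)) (hLowSign_cases B y)
  have hss := pm_eq_of_mul_eq (hσ (y 1 - 1)) (hσ (y 1))
  rcases pm_mul (hσ (y 1 - 1)) (hσ (y 1)) with hp | hp
  · have heq : rowChi σ (cTgt (y, 3)) = rowChi σ (cSrc (y, 3)) := by rw [h1, h2, hss.1 hp]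
    rw [hp] at hsign
    exact (isAntiAt_sign_mul_iff (χ := rowChi σ) hχ heq).2
      (isAntiAt_kcObs_three G₂ hG hle hT he hstep (hhv.2 hsign))
  · have hop : rowChi σ (cTgt (y, 3)) = -rowChi σ (cSrc (y, 3)) := by rw [h1, h2]; rw [hss.2 hp]; ring
    rw [hp, neg_neg] at hsign
    exact ((isSHolAt_sign_mul_iff_anti (χ := rowChi σ) hχ hop).2).2
      (isSHolAt_kcObs_three G₂ hG hle hT he hstep (hhv.1 hsign))

/-- **`D` at the `NE` corners**: always s-holomorphic. [cite: ChelkakHonglerIzyurovAnnals2015, Lemma 3.5 and Remark 3.9] -/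
theorem isSHolAt_kcDiffG_zero (hσ : ∀ r, σ r = 1 ∨ σ r = -1)
    (hG : ∀ v ∈ Λ, ∀ k : Fin 4, G₂.Adj v (v + cornerUnit k)) (hle : G₂ ≤ zdGraph 2)
    (p₀ : Site 2) (S : ℝ) {y : Site 2} (hT : cut (faceAt y 1) ⊆ edgesTouching G₂ Λ) (he : s(y, y + cornerUnit 1) ∈ edgesTouching G₂ Λ)
    (hstep : KCGaugeEquiv G₂ Λ (symmDiff (cut (faceAt y 1)) {s(y, y + cornerUnit 1)}) (cut (faceAt y 0))) :
    IsSHolAt (kcDiffG G₂ σ Λ η B cut p₀ S) (y, 0) :=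
  isSHolAt_sub_smul S (isSHolAt_rowGauge_kcObs_zero G₂ hσ hG hle hT he hstep) (isSHolAt_slitFCg_zero p₀ y)

/-- **`D` at the `NW` corners**: always s-holomorphic. [cite: ChelkakHonglerIzyurovAnnals2015, Lemma 3.5 and Remark 3.9] -/
theorem isSHolAt_kcDiffG_one (hσ : ∀ r, σ r = 1 ∨ σ r = -1)
    (hG : ∀ v ∈ Λ, ∀ k : Fin 4, G₂.Adj v (v + cornerUnit k)) (hle : G₂ ≤ zdGraph 2)
    (p₀ : Site 2) (S : ℝ) {y : Site 2} (hT : cut (faceAt y 1) ⊆ edgesTouching G₂ Λ)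
    (he : s(y + cornerUnit 2, y + cornerUnit 2 + cornerUnit 0) ∈ edgesTouching G₂ Λ)
    (hstep : KCGaugeEquiv G₂ Λ (symmDiff (cut (faceAt y 1)) {s(y + cornerUnit 2, y + cornerUnit 2 + cornerUnit 0)})
      (cut (faceAt y 2))) :
    IsSHolAt (kcDiffG G₂ σ Λ η B cut p₀ S) (y, 1) :=
  isSHolAt_sub_smul S (isSHolAt_rowGauge_kcObs_one G₂ hσ hG hle hT he hstep) (isSHolAt_slitFCg_one p₀ y)

/-- **`D` at the `SW` corners off the seam and off the source**: s-holomorphic where the gauged section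
is. [cite: ChelkakHonglerIzyurovAnnals2015, Lemma 3.5 and Remark 3.9] -/
theorem isSHolAt_kcDiffG_two (hσ : ∀ r, σ r = 1 ∨ σ r = -1)
    (hG : ∀ v ∈ Λ, ∀ k : Fin 4, G₂.Adj v (v + cornerUnit k)) (hle : G₂ ≤ zdGraph 2)
    (p₀ : Site 2) (S : ℝ) {y : Site 2} (hT : cut (faceAt y 2) ⊆ edgesTouching G₂ Λ)
    (he : s(y + cornerUnit 3, y + cornerUnit 3 + cornerUnit 1) ∈ edgesTouching G₂ Λ)
    (hstep : KCGaugeEquiv G₂ Λ (symmDiff (cut (faceAt y 2)) {s(y + cornerUnit 3, y + cornerUnit 3 + cornerUnit 1)})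
      (cut (faceAt y 3)))
    (hsign : hLowSign B (y + cornerUnit 2) * vLowSign B cut (y + cornerUnit 3) = σ (y 1 - 1) * σ (y 1))
    (hseam : ¬(srcJ p₀ y = 0 ∧ 1 ≤ srcI p₀ y)) (hsrc : ¬(srcI p₀ y = 0 ∧ srcJ p₀ y = 0)) :
    IsSHolAt (kcDiffG G₂ σ Λ η B cut p₀ S) (y, 2) :=
  isSHolAt_sub_smul S (isSHolAt_rowGauge_kcObs_two G₂ hσ hG hle hT he hstep hsign) (isSHolAt_slitFCg_two p₀ y hseam hsrc)

/-- **`D` on the seam, `SW` corners**: anti where the gauged section is. [cite: ChelkakHonglerIzyurovAnnals2015, Lemma 3.5 (on the double cover)] -/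
theorem isAntiAt_kcDiffG_two (hσ : ∀ r, σ r = 1 ∨ σ r = -1)
    (hG : ∀ v ∈ Λ, ∀ k : Fin 4, G₂.Adj v (v + cornerUnit k)) (hle : G₂ ≤ zdGraph 2)
    (p₀ : Site 2) (S : ℝ) {y : Site 2} (hT : cut (faceAt y 2) ⊆ edgesTouching G₂ Λ)
    (he : s(y + cornerUnit 3, y + cornerUnit 3 + cornerUnit 1) ∈ edgesTouching G₂ Λ)
    (hstep : KCGaugeEquiv G₂ Λ (symmDiff (cut (faceAt y 2)) {s(y + cornerUnit 3, y + cornerUnit 3 + cornerUnit 1)})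
      (cut (faceAt y 3)))
    (hsign : hLowSign B (y + cornerUnit 2) * vLowSign B cut (y + cornerUnit 3) = -(σ (y 1 - 1) * σ (y 1)))
    (hJ : srcJ p₀ y = 0) (hI : 1 ≤ srcI p₀ y) :
    IsAntiAt (kcDiffG G₂ σ Λ η B cut p₀ S) (y, 2) :=
  anti_sub_smul S (isAntiAt_rowGauge_kcObs_two G₂ hσ hG hle hT he hstep hsign) (isAntiAt_slitFCg_two p₀ y hJ hI)

/-- **`D` at the `SE` corners off the seam**: s-holomorphic where the gauged section is. [cite: ChelkakHonglerIzyurovAnnals2015, Lemma 3.5 and Remark 3.9] -/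
theorem isSHolAt_kcDiffG_three (hσ : ∀ r, σ r = 1 ∨ σ r = -1)
    (hG : ∀ v ∈ Λ, ∀ k : Fin 4, G₂.Adj v (v + cornerUnit k)) (hle : G₂ ≤ zdGraph 2)
    (p₀ : Site 2) (S : ℝ) {y : Site 2} (hT : cut (faceAt y 0) ⊆ edgesTouching G₂ Λ) (he : s(y, y + cornerUnit 0) ∈ edgesTouching G₂ Λ)
    (hstep : KCGaugeEquiv G₂ Λ (symmDiff (cut (faceAt y 0)) {s(y, y + cornerUnit 0)}) (cut (faceAt y 3)))
    (hsign : vLowSign B cut (y + cornerUnit 3) * hLowSign B y = σ (y 1 - 1) * σ (y 1))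
    (hseam : ¬(srcJ p₀ y = 0 ∧ 0 ≤ srcI p₀ y)) :
    IsSHolAt (kcDiffG G₂ σ Λ η B cut p₀ S) (y, 3) :=
  isSHolAt_sub_smul S (isSHolAt_rowGauge_kcObs_three G₂ hσ hG hle hT he hstep hsign) (isSHolAt_slitFCg_three p₀ y hseam)

/-- **`D` on the seam, `SE` corners**: anti where the gauged section is. [cite: ChelkakHonglerIzyurovAnnals2015, Lemma 3.5 (on the double cover)] -/
theorem isAntiAt_kcDiffG_three (hσ : ∀ r, σ r = 1 ∨ σ r = -1)
    (hG : ∀ v ∈ Λ, ∀ k : Fin 4, G₂.Adj v (v + cornerUnit k)) (hle : G₂ ≤ zdGraph 2)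
    (p₀ : Site 2) (S : ℝ) {y : Site 2} (hT : cut (faceAt y 0) ⊆ edgesTouching G₂ Λ) (he : s(y, y + cornerUnit 0) ∈ edgesTouching G₂ Λ)
    (hstep : KCGaugeEquiv G₂ Λ (symmDiff (cut (faceAt y 0)) {s(y, y + cornerUnit 0)}) (cut (faceAt y 3)))
    (hsign : vLowSign B cut (y + cornerUnit 3) * hLowSign B y = -(σ (y 1 - 1) * σ (y 1))) (hJ : srcJ p₀ y = 0) (hI : 0 ≤ srcI p₀ y) :
    IsAntiAt (kcDiffG G₂ σ Λ η B cut p₀ S) (y, 3) :=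
  anti_sub_smul S (isAntiAt_rowGauge_kcObs_three G₂ hσ hG hle hT he hstep hsign) (isAntiAt_slitFCg_three p₀ y hJ hI)

end Table

end Literature.Probability.LatticeModels
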